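import Summits.ResolutionOfSingularities.ResolutionOfSingularities.Theorems.HilbertSamuelEliminationSigmaMaxModificationsCorridor3WLadderSegmentsTowerL
import Summits.ResolutionOfSingularities.ResolutionOfSingularities.Theorems.HilbertSamuelEliminationSigmaMaxModificationsCorridor3WLadderSegmentsCentreOne
import HarnessLib

/-!
# [OURS · L1 W4.2] THE BIRTH STEP AT AN INTERIOR GENUINE STAGE OF THE UNIT: the near-point geometry of ONE blow-up (stub-2's
# `dichPlus_nearLocus_succ` / `nearLocus_succ_shape`, CJS Lemma 6.33 / Def. 6.34) read on the partially compressed tower `Seg.unitTowerL`,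
# transferred back to the chain — (Dich⁺)/(RegN) at the next stage from the invariant's data at the earlier stages
# (crux `SigmaMaxModifications` stmt-ResolutionOfSingularities-18506; conjunct `SigmaMaxModificationsCorridor3` stmt-…-19249; line `w_ladder`; RECOGNITION assembly, Step A)

Stub worker res-L1-w42-stub-1 (gen 4). Helper file `--supports stmt-ResolutionOfSingularities-19249 --as helper`; kernel only, no new definition. PRINTED
FACTS used as binders (the char row's): `Thm314_point_locus`, `CossartJannsenSaito2020_thm_3_14`, `Thm314_nearFibre_subsingleton`,
`CossartJannsenSaito2020_thm_3_6`, `CossartJannsenSaito2020_thm_3_10_4`; (F1) `CharHypothesis` at `x_b`.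

* `Seg.isGenericPoint_iff_of_isEmbedding` — generic points correspond under an embedding `f` between `M = f⁻¹ N` and `N = f(M)` (topology).
* **`Seg.dichPlus_regN_birth`** — at the `L`-th blown-up stage `r = relIdxL b L L` of the unit based at a blown-up isolated stage `b` (`1 ≤ L`),
  GIVEN: (H-emp) below `relIdx b L`; «`N ⊆ C`» at the kept stages of rank `≤ L`; and the curve data of `N_r` (infinite, irreducible, non-generic
  points closed) — PRODUCE at the next chain stage `r' = relIdxL b L (L+1)` (`= relIdx b L + 1`): either «`N_{r'}` infinite, irreducible, with
  closed non-generic points, and regular (reduced)» or «`N_{r'}` finite with closed points». All inputs are the data of `Seg.invariant_strongPlus`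
  at stages `≤ r`; so the birth hypothesis of that induction is DISCHARGED at interior births modulo the printed facts (the first birth, over the
  point `x_b`, is `…CentreOne`/Thm. 3.14 territory and is not treated here).

OURS bookkeeping; NOT a statement of the manuscript [Hironaka2017] nor of [CossartJannsenSaito2020]. AI-written; AI review is weaker than expert
review.

References: V. Cossart, U. Jannsen, S. Saito, LNM 2270 (2020), Lemma 6.33, Def. 6.34, Def. 6.38, Thm. 3.14, p. 104–107 [CossartJannsenSaito2020].
-/

noncomputable section

set_option linter.dupNamespace false -- namespace `…Corridor3.Moving` re-enters `…Corridor3` (module convention of the Moving files)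

open CategoryTheory AlgebraicGeometry TopologicalSpace Topology IsLocalRing
open Literature.AlgebraicGeometry.Resolution Literature.RingTheory.HilbertSamuel
open Literature.AlgebraicGeometry.CossartJannsenSaito2020
open Summit.ResolutionOfSingularities.ResolutionOfSingularities.Theorems.CampaignW42
open Summit.ResolutionOfSingularities.ResolutionOfSingularities.Theorems.SigmaMaxModificationsCorridor3.Helpers

namespace Summit.ResolutionOfSingularities.ResolutionOfSingularities.Theorems.SigmaMaxModificationsCorridor3.Moving.Seg

/-! ## §1. Generic points under an embedding -/

/-- **Generic points correspond under an embedding**: for an embedding `f`, a closed `N` with `f(f⁻¹ N) = N`, and `s ∈ f⁻¹ N`: `s` is a generic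
point of `f⁻¹ N` iff `f s` is a generic point of `N`. [folklore] -/
theorem isGenericPoint_iff_of_isEmbedding {α β : Type*} [TopologicalSpace α] [TopologicalSpace β] {f : α → β} (hf : Topology.IsEmbedding f)
    {N : Set β} (hNcl : IsClosed N) (hsurj : f '' (f ⁻¹' N) = N) {s : α} (hs : s ∈ f ⁻¹' N) :
    IsGenericPoint s (f ⁻¹' N) ↔ IsGenericPoint (f s) N := by
  have hcl : closure ({s} : Set α) = f ⁻¹' closure {f s} := by
    rw [hf.isInducing.closure_eq_preimage_closure_image, Set.image_singleton]
  rw [isGenericPoint_def, isGenericPoint_def]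
  constructor
  · intro h
    refine Set.Subset.antisymm (closure_minimal (Set.singleton_subset_iff.mpr (show f s ∈ N from hs)) hNcl) ?_
    calc N = f '' (f ⁻¹' N) := hsurj.symm
      _ = f '' closure {s} := by rw [h]
      _ ⊆ closure (f '' {s}) := image_closure_subset_closure_image hf.continuous
      _ = closure {f s} := by rw [Set.image_singleton]
  · intro h
    rw [hcl, h]

/-! ## §2. The birth step at an interior genuine stage -/

section Birth

variable {R : ∀ S : Scheme.{0}, CentreSeq S → Prop} {N : ℕ} {ν : ℕ → ℕ} {k : Type} [Field k]
  {c : ℕ → MarkedStage.{0}} (hc : ∀ n, CanonicalNearStep R N ν (c n) (c (n + 1))) (hRa : OracleAdmissible R)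
  (hν : ν ≠ iterPSum N Phi) (h0 : Helpers.CycleInv k N ν (c 0)) (hgen : ∀ n, ∃ m, n ≤ m ∧ (c m).IsBlownUp R N ν)
  {p : ℕ} {X : Scheme.{0}} [IsLocallyNoetherian X] {x : X} (hX : IsMaximalOrigin p N ν X x)
  (hreach : Reaches R N ν (MarkedStage.init X x) (c 0))

include hX hreach in
/-- **THE BIRTH STEP (interior).** See the module docstring. [cite: CossartJannsenSaito2020, Lemma 6.33, Def. 6.34, Def. 6.38 (iii)–(v)] -/
theorem dichPlus_regN_birth (h314pt : Thm314_point_locus.{0}) (h314 : CossartJannsenSaito2020_thm_3_14.{0})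
    (h314f : Thm314_nearFibre_subsingleton.{0}) (h36 : CossartJannsenSaito2020_thm_3_6.{0}) (h3104 : CossartJannsenSaito2020_thm_3_10_4.{0})
    (b : ℕ) (hU : ∃ U : Set (c b).W, IsOpen U ∧ (c b).pt ∈ U ∧ U ∩ Scheme.hsStratum (c b).W N ν ⊆ {(c b).pt})
    (hchar : CharHypothesis (c b).W (c b).pt) (hē : (c b).geomDirDim ≤ 2) (L : ℕ)
    (hempL : ∀ n, n < Seg.relIdx hgen b L → ¬ (c (b + n)).IsBlownUp R N ν → (locTower hc hRa hν h0 b).C n = ∅)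
    (hNC : ∀ i, i ≤ L → (upTower hc hRa hν h0 b).nearLocus N (c b).pt (Seg.relIdxL hgen b L i) ⊆ (upTower hc hRa hν h0 b).C (Seg.relIdxL hgen b L i))
    (hinf : ((upTower hc hRa hν h0 b).nearLocus N (c b).pt (Seg.relIdxL hgen b L L)).Infinite)
    (hirr : IsIrreducible ((upTower hc hRa hν h0 b).nearLocus N (c b).pt (Seg.relIdxL hgen b L L)))
    (hpts : ∀ y ∈ (upTower hc hRa hν h0 b).nearLocus N (c b).pt (Seg.relIdxL hgen b L L),
      ¬ IsGenericPoint y ((upTower hc hRa hν h0 b).nearLocus N (c b).pt (Seg.relIdxL hgen b L L)) →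
        IsClosed ({y} : Set (c (b + Seg.relIdxL hgen b L L)).W)) :
    ((((upTower hc hRa hν h0 b).nearLocus N (c b).pt (Seg.relIdxL hgen b L (L + 1))).Infinite ∧
        IsIrreducible ((upTower hc hRa hν h0 b).nearLocus N (c b).pt (Seg.relIdxL hgen b L (L + 1))) ∧
        ∀ y ∈ (upTower hc hRa hν h0 b).nearLocus N (c b).pt (Seg.relIdxL hgen b L (L + 1)),
          ¬ IsGenericPoint y ((upTower hc hRa hν h0 b).nearLocus N (c b).pt (Seg.relIdxL hgen b L (L + 1))) →
            IsClosed ({y} : Set (c (b + Seg.relIdxL hgen b L (L + 1))).W)) ∨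
      (((upTower hc hRa hν h0 b).nearLocus N (c b).pt (Seg.relIdxL hgen b L (L + 1))).Finite ∧
        ∀ y ∈ (upTower hc hRa hν h0 b).nearLocus N (c b).pt (Seg.relIdxL hgen b L (L + 1)),
          IsClosed ({y} : Set (c (b + Seg.relIdxL hgen b L (L + 1))).W))) ∧
    (((upTower hc hRa hν h0 b).nearLocus N (c b).pt (Seg.relIdxL hgen b L (L + 1))).Infinite →
      ∀ h : IsClosed ((upTower hc hRa hν h0 b).nearLocus N (c b).pt (Seg.relIdxL hgen b L (L + 1))),
        Scheme.IsRegular (Scheme.IdealSheafData.vanishingIdeal ⟨(upTower hc hRa hν h0 b).nearLocus N (c b).pt (Seg.relIdxL hgen b L (L + 1)), h⟩).subscheme) := by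
  haveI : IsLocallyNoetherian ((upTower hc hRa hν h0 b).X 0) := (upTower hc hRa hν h0 b).ln 0
  haveI : IsLocallyNoetherian (c b).W := (c b).ln
  haveI := flat_fromSpecStalk ((upTower hc hRa hν h0 b).X 0) ((c b).pt : (upTower hc hRa hν h0 b).X 0)
  -- the partially compressed tower and its data
  haveI hNoe : IsNoetherian ((unitTowerL hc hRa hν h0 hgen b L hempL).X 0) := by
    show IsNoetherian (Spec ((c b).W.presheaf.stalk (c b).pt)); infer_instance
  have hkey := keySetting_unitTowerL hc hRa hν h0 hgen hempL (N := N)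
  have hperm := isPermissible_centreIdeal_unitTowerL hc hRa hν h0 hgen hempL (N := N)
  have hcl := isClosed_hsStratumGE_unitTowerL hc hRa hν h0 hgen hempL (N := N)
  have hx : IsClosed ({basePt hc hRa hν h0 b} : Set ((unitTowerL hc hRa hν h0 hgen b L hempL).X 0)) := isClosed_singleton_closedPoint _
  have hcharT := charHypothesis_unitTowerL hc hRa hν h0 hgen hempL hchar
  have hēT : (unitTowerL hc hRa hν h0 hgen b L hempL).geomDirDimAt 0 (basePt hc hRa hν h0 b) ≤ 2 := by
    have : (unitTowerL hc hRa hν h0 hgen b L hempL).geomDirDimAt 0 (basePt hc hRa hν h0 b) = (c b).geomDirDim :=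
      Scheme.geomDirDim_fromSpecStalk_closedPoint (c b).W (c b).pt
    rw [this]; exact hē
  -- `N ⊆ C` at the kept stages, `C_L = N_L`
  have hNCT : ∀ i, i ≤ L → (unitTowerL hc hRa hν h0 hgen b L hempL).nearLocus N (basePt hc hRa hν h0 b) i ⊆ (unitTowerL hc hRa hν h0 hgen b L hempL).C i := by
    intro i hi
    rw [nearLocus_unitTowerL, unitTowerL_C]
    exact Set.preimage_mono (hNC i hi)
  have hCNT : (unitTowerL hc hRa hν h0 hgen b L hempL).C L = (unitTowerL hc hRa hν h0 hgen b L hempL).nearLocus N (basePt hc hRa hν h0 b) L :=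
    unitTowerL_C_eq_nearLocus_of_subset hc hRa hν h0 hgen hempL hX hreach hU L (hNC L le_rfl)
  -- curve data of `C_L = ι⁻¹ N_r`
  have hCeq : (unitTowerL hc hRa hν h0 hgen b L hempL).C L =
      (locι hc hRa hν h0 b (Seg.relIdxL hgen b L L)).base ⁻¹' (upTower hc hRa hν h0 b).nearLocus N (c b).pt (Seg.relIdxL hgen b L L) := by
    rw [hCNT, nearLocus_unitTowerL]
  have hrange : ∀ q, (upTower hc hRa hν h0 b).nearLocus N (c b).pt q ⊆ Set.range (locι hc hRa hν h0 b q).base := fun q => by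
    have h := BlowupTowerNear.nearLocus_subset_range_bcι (upTower hc hRa hν h0 b)
      (((upTower hc hRa hν h0 b).X 0).fromSpecStalk ((c b).pt : (upTower hc hRa hν h0 b).X 0)) N (basePt hc hRa hν h0 b) q
    rw [show (((upTower hc hRa hν h0 b).X 0).fromSpecStalk ((c b).pt : (upTower hc hRa hν h0 b).X 0)).base (basePt hc hRa hν h0 b) = (c b).pt
      from Scheme.fromSpecStalk_closedPoint] at h
    exact h
  have hemb : ∀ q, Topology.IsEmbedding (locι hc hRa hν h0 b q).base := fun q =>
    @Scheme.Hom.isEmbedding _ _ (locι hc hRa hν h0 b q)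
      ((upTower hc hRa hν h0 b).isPreimmersion_bcι (((upTower hc hRa hν h0 b).X 0).fromSpecStalk ((c b).pt : (upTower hc hRa hν h0 b).X 0)) _)
  have hsurj : ∀ q, (locι hc hRa hν h0 b q).base '' ((locι hc hRa hν h0 b q).base ⁻¹' (upTower hc hRa hν h0 b).nearLocus N (c b).pt q) =
      (upTower hc hRa hν h0 b).nearLocus N (c b).pt q := fun q =>
    Set.image_preimage_eq_of_subset (hrange q)
  have hirrT : IsIrreducible ((unitTowerL hc hRa hν h0 hgen b L hempL).C L) := by
    rw [hCeq]; exact isIrreducible_preimage_of_isEmbedding (hemb _) hirr (hrange _)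
  have hntT : ((unitTowerL hc hRa hν h0 hgen b L hempL).C L).Nontrivial := by
    rw [hCeq]; exact (hinf.preimage (hrange _)).nontrivial
  have hptsT : ∀ y ∈ (unitTowerL hc hRa hν h0 hgen b L hempL).C L, ¬ IsGenericPoint y ((unitTowerL hc hRa hν h0 hgen b L hempL).C L) →
      IsClosed ({y} : Set ((unitTowerL hc hRa hν h0 hgen b L hempL).X L)) := by
    rw [hCeq]
    intro s hs hng
    have hng' : ¬ IsGenericPoint ((locι hc hRa hν h0 b (Seg.relIdxL hgen b L L)).base s)
        ((upTower hc hRa hν h0 b).nearLocus N (c b).pt (Seg.relIdxL hgen b L L)) := fun h =>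
      hng ((isGenericPoint_iff_of_isEmbedding (hemb _) (isClosed_nearLocus hc hRa hν h0 hX hreach b _) (hsurj _) hs).mpr h)
    have hclosed := hpts _ hs hng'
    have : ({s} : Set ((unitTowerL hc hRa hν h0 hgen b L hempL).X L)) =
        (locι hc hRa hν h0 b (Seg.relIdxL hgen b L L)).base ⁻¹' {(locι hc hRa hν h0 b (Seg.relIdxL hgen b L L)).base s} := by
      rw [← Set.image_singleton]; exact ((hemb (Seg.relIdxL hgen b L L)).injective.preimage_image {s}).symm
    rw [this]
    exact hclosed.preimage (locι hc hRa hν h0 b _).continuous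
  have hη := hirrT.isGenericPoint_genericPoint ((unitTowerL hc hRa hν h0 hgen b L hempL).isClosed_C L)
  -- stub-2's one-step lemmas on the partially compressed tower
  have hshape := BlowupTowerNear.nearLocus_succ_shape h314f h36 h3104 hkey hperm hcl hx hcharT hēT hNCT hCNT.le hirrT hntT hptsT hη
  have hplus := BlowupTowerNear.dichPlus_nearLocus_succ h314pt h314 h314f h36 h3104 hkey hperm hcl hx hcharT hēT hNCT hCNT.le hirrT hntT hptsT
  -- the next stage of the partially compressed tower is the localised chain stage `r'`
  have hNeq : (unitTowerL hc hRa hν h0 hgen b L hempL).nearLocus N (basePt hc hRa hν h0 b) (L + 1) =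
      (locTower hc hRa hν h0 b).nearLocus N (basePt hc hRa hν h0 b) (Seg.relIdxL hgen b L (L + 1)) :=
    (locTower hc hRa hν h0 b).nearLocus_compress_zero (htriv_of_hEmpL hc hRa hν h0 hgen hempL) N (basePt hc hRa hν h0 b) (L + 1)
  have hNeq' : (unitTowerL hc hRa hν h0 hgen b L hempL).nearLocus N (basePt hc hRa hν h0 b) (L + 1) =
      (locι hc hRa hν h0 b (Seg.relIdxL hgen b L (L + 1))).base ⁻¹' (upTower hc hRa hν h0 b).nearLocus N (c b).pt (Seg.relIdxL hgen b L (L + 1)) :=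
    nearLocus_unitTowerL hc hRa hν h0 hgen hempL (L + 1)
  have hxb : IsClosed ({(((upTower hc hRa hν h0 b).X 0).fromSpecStalk ((c b).pt : (upTower hc hRa hν h0 b).X 0)).base (basePt hc hRa hν h0 b)} :
      Set ((upTower hc hRa hν h0 b).X 0)) := by
    rw [show (((upTower hc hRa hν h0 b).X 0).fromSpecStalk ((c b).pt : (upTower hc hRa hν h0 b).X 0)).base (basePt hc hRa hν h0 b) = (c b).pt
      from Scheme.fromSpecStalk_closedPoint]
    exact Reaches.isClosed_pt hX.isClosed (reaches_chain hreach hc b)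
  have hNcl' : IsClosed ((upTower hc hRa hν h0 b).nearLocus N (c b).pt (Seg.relIdxL hgen b L (L + 1))) :=
    isClosed_nearLocus hc hRa hν h0 hX hreach b _
  -- closed points of the localised near locus over the base map to closed points of the chain stage
  have hclUp : ∀ s ∈ (unitTowerL hc hRa hν h0 hgen b L hempL).nearLocus N (basePt hc hRa hν h0 b) (L + 1),
      IsClosed ({s} : Set ((unitTowerL hc hRa hν h0 hgen b L hempL).X (L + 1))) →
      IsClosed ({(locι hc hRa hν h0 b (Seg.relIdxL hgen b L (L + 1))).base s} : Set (c (b + Seg.relIdxL hgen b L (L + 1))).W) := by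
    intro s hs hscl
    rw [hNeq] at hs
    exact BlowupTowerNear.isClosed_singleton_bcι_of_phi_eq (upTower hc hRa hν h0 b)
      (((upTower hc hRa hν h0 b).X 0).fromSpecStalk ((c b).pt : (upTower hc hRa hν h0 b).X 0)) (basePt hc hRa hν h0 b) _ hxb hs.1 hscl
  refine ⟨?_, fun hinf' h' => ?_⟩
  · rcases hshape with ⟨hfin, hcls, -, -⟩ | ⟨himg1, -, -, hirr1, -, hpts1⟩
    · refine Or.inr ⟨?_, fun y hy => ?_⟩
      · have hfin' : ((locι hc hRa hν h0 b (Seg.relIdxL hgen b L (L + 1))).base ⁻¹'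
            (upTower hc hRa hν h0 b).nearLocus N (c b).pt (Seg.relIdxL hgen b L (L + 1))).Finite := by rw [← hNeq']; exact hfin
        have := hfin'.image (locι hc hRa hν h0 b (Seg.relIdxL hgen b L (L + 1))).base
        rwa [hsurj] at this
      · obtain ⟨s, hs, rfl⟩ := (hsurj (Seg.relIdxL hgen b L (L + 1))).symm.subset hy |> fun h => h
        have hs' : s ∈ (unitTowerL hc hRa hν h0 hgen b L hempL).nearLocus N (basePt hc hRa hν h0 b) (L + 1) := by rw [hNeq']; exact hs
        exact hclUp s hs' (hcls s hs')
    · refine Or.inl ⟨?_, ?_, fun y hy hng => ?_⟩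
      · -- infinite: `π_{L+1}` maps `N_{L+1}` ONTO the infinite `C_L`, and `ι` is injective
        have hinfC : ((unitTowerL hc hRa hν h0 hgen b L hempL).C L).Infinite := by rw [hCeq]; exact hinf.preimage (hrange _)
        have hinfT : ((unitTowerL hc hRa hν h0 hgen b L hempL).nearLocus N (basePt hc hRa hν h0 b) (L + 1)).Infinite :=
          Set.Infinite.of_image _ (himg1.symm ▸ hinfC)
        have hinfT' : ((locι hc hRa hν h0 b (Seg.relIdxL hgen b L (L + 1))).base ⁻¹'
            (upTower hc hRa hν h0 b).nearLocus N (c b).pt (Seg.relIdxL hgen b L (L + 1))).Infinite := by rw [← hNeq']; exact hinfT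
        have := hinfT'.image ((hemb (Seg.relIdxL hgen b L (L + 1))).injective.injOn)
        rwa [hsurj] at this
      · have h1 : IsIrreducible ((locι hc hRa hν h0 b (Seg.relIdxL hgen b L (L + 1))).base ⁻¹'
            (upTower hc hRa hν h0 b).nearLocus N (c b).pt (Seg.relIdxL hgen b L (L + 1))) := by rw [← hNeq']; exact hirr1
        have := h1.image _ (locι hc hRa hν h0 b _).continuous.continuousOn
        rwa [hsurj] at this
      · obtain ⟨s, hs, rfl⟩ := (hsurj (Seg.relIdxL hgen b L (L + 1))).symm.subset hy
        have hs' : s ∈ (unitTowerL hc hRa hν h0 hgen b L hempL).nearLocus N (basePt hc hRa hν h0 b) (L + 1) := by rw [hNeq']; exact hs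
        refine hclUp s hs' (hpts1 s hs' fun hgs => hng ?_)
        have hgs' : IsGenericPoint s ((locι hc hRa hν h0 b (Seg.relIdxL hgen b L (L + 1))).base ⁻¹'
            (upTower hc hRa hν h0 b).nearLocus N (c b).pt (Seg.relIdxL hgen b L (L + 1))) := by rw [← hNeq']; exact hgs
        exact (isGenericPoint_iff_of_isEmbedding (hemb _) hNcl' (hsurj _) hs).mp hgs'
  · -- regularity of the reduced near locus at `r'`, from the dominant branch of `dichPlus_nearLocus_succ`
    have hS : IsClosed ((unitTowerL hc hRa hν h0 hgen b L hempL).nearLocus N (basePt hc hRa hν h0 b) (L + 1)) := by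
      rw [hNeq']; exact hNcl'.preimage (locι hc hRa hν h0 b _).continuous
    rcases hplus with ⟨-, -, -, hreg⟩ | ⟨hfin, -⟩
    · have hregS := hreg hS
      have hS' : IsClosed ((locTower hc hRa hν h0 b).nearLocus N (basePt hc hRa hν h0 b) (Seg.relIdxL hgen b L (L + 1))) := by
        rw [← hNeq]; exact hS
      have hregS' : Scheme.IsRegular (Scheme.IdealSheafData.vanishingIdeal
          (⟨(locTower hc hRa hν h0 b).nearLocus N (basePt hc hRa hν h0 b) (Seg.relIdxL hgen b L (L + 1)), hS'⟩ :
            Closeds ((locTower hc hRa hν h0 b).X (Seg.relIdxL hgen b L (L + 1))))).subscheme := by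
        have e : (⟨(unitTowerL hc hRa hν h0 hgen b L hempL).nearLocus N (basePt hc hRa hν h0 b) (L + 1), hS⟩ :
            Closeds ((locTower hc hRa hν h0 b).X (Seg.relIdxL hgen b L (L + 1)))) =
            ⟨(locTower hc hRa hν h0 b).nearLocus N (basePt hc hRa hν h0 b) (Seg.relIdxL hgen b L (L + 1)), hS'⟩ := Closeds.ext hNeq
        rw [← e]; exact hregS
      exact BlowupTowerNear.isRegular_nearLocus_of_localize (upTower hc hRa hν h0 b) N (c b).pt _ hS' h' hregS'
    · exfalso
      apply hinf'
      have hfin' : ((locι hc hRa hν h0 b (Seg.relIdxL hgen b L (L + 1))).base ⁻¹'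
          (upTower hc hRa hν h0 b).nearLocus N (c b).pt (Seg.relIdxL hgen b L (L + 1))).Finite := by rw [← hNeq']; exact hfin
      have := hfin'.image (locι hc hRa hν h0 b (Seg.relIdxL hgen b L (L + 1))).base
      rwa [hsurj] at this

end Birth

end Summit.ResolutionOfSingularities.ResolutionOfSingularities.Theorems.SigmaMaxModificationsCorridor3.Moving.Seg

end
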